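import Summits.ValiantsHypothesis.ValiantsHypothesis.Theorems.MonotoneRestorationOrbitRestorationQPDerivativeTowerWaring
import Summits.ValiantsHypothesis.ValiantsHypothesis.Theorems.MonotoneRestorationOrbitRestorationQPDerivativeTowerAlt
import HarnessLib

/-!
# ΣΛΣ restoration modulo the small-modules ALT-spanning property (the meaningful conditional rung)

Route MonotoneRestoration, crux `OrbitRestorationQP` (stmt-ValiantsHypothesis-18293), line `depth-three-rung`,
stub A_∞ `stub_sigmaPiSigmaValue`.  Namespace `Summit.ValiantsHypothesis.ValiantsHypothesis.Theorems.DerivativeTower`.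

`…DerivativeTowerWaring.lean` proved the ΣΛΣ rung modulo the hypothesis that small matrix-stable subspaces are
spanned by their SUPPORTED members (fixed by all permutations fixing few indices).  That hypothesis is too
strong to be true in general: the line spanned by `Σ_q Π_{p<p'} (x_{pq} − x_{p'q})` is matrix-stable of
dimension `1` and contains no nonzero supported vector (odd permutations negate it).  The correct
representation-theoretic statement uses ALTERNATING supports (fixed by all EVEN permutations fixing few
indices): modules `S^λ ⊠ S^μ` of small dimension have `λ, μ` of small depth or small co-depth, and all of these
have alt-supported spanning vectors.  With the alt-supported tower theorem (`…DerivativeTowerAlt.lean`):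

* `sigmaLambdaSigma_restorable_of_smallModulesAltSupported` — **if every finite-dimensional matrix-stable
  subspace of dimension `≤ r` is spanned by its `k`-alt-supported members, then every matrix-symmetric
  `f = Σ_{i<r} a_i ℓ_{w_i}^d` is `QPOrbitRestorable (k + 7) n f`;**
* `sigmaLambdaSigma_restoration_of_smallModulesAltSupported` — the family form in the format of the rung
  (`r_n, d_n` arbitrary; the hypothesis quantified at every level with one `k`).

Honest label: the ΣΛΣ sub-rung of A_∞ modulo ONE statement of the representation theory of `S_n × S_n`
(hypothesis `hKey`; true for `n ≥ n₀(r)` with `k = O(log_n r)` by Rasala's minimal-degree theorem and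
Pieri's rule — not formalised here); A_∞ and the crux stay open; VP ≠ VNP untouched. [folklore]
-/

noncomputable section

open scoped Classical

-- `Summit.ValiantsHypothesis.ValiantsHypothesis.…` is the tree's single-conjunct layout (Sub = Summit).
set_option linter.dupNamespace false

namespace Summit.ValiantsHypothesis.ValiantsHypothesis.Theorems

namespace DerivativeTower

open MvPolynomial Finset Equiv OrbitRestorationQPDepthThreeRung WaringJennrich LevelStructure

variable {n : ℕ}

/-- **ΣΛΣ RESTORATION MODULO THE SMALL-MODULES ALT-SPANNING PROPERTY.**  Suppose (`hKey`) that every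
finite-dimensional subspace of polynomials on the `n × n` matrix of dimension `≤ r`, stable under the whole
matrix action, is spanned by its members fixed by all EVEN permutations fixing pointwise some `≤ k` indices.
Then every matrix-symmetric Waring expression `f = Σ_{i<r} a_i ℓ_{w_i}^d` is `QPOrbitRestorable (k + 7) n f`.
[folklore] -/
theorem sigmaLambdaSigma_restorable_of_smallModulesAltSupported {k r d : ℕ}
    (hKey : ∀ W : Submodule ℂ (MvPolynomial (Fin n × Fin n) ℂ), FiniteDimensional ℂ W →
      Module.finrank ℂ W ≤ r → (∀ σ τ : Perm (Fin n), ∀ w ∈ W, mact σ τ w ∈ W) →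
        W ≤ Submodule.span ℂ {v | v ∈ W ∧ ∃ Y : Finset (Fin n), Y.card ≤ k ∧
          ∀ ρ : Perm (Fin n), (∀ i ∈ Y, ρ i = i) → Perm.sign ρ = 1 → ren ρ v = v})
    (w : Fin r → (Fin n × Fin n) → ℂ) (a : Fin r → ℂ) {f : MvPolynomial (Fin n × Fin n) ℂ}
    (hf : f = ∑ i, C (a i) * lin (w i) ^ d) (hsym : ∀ σ τ : Perm (Fin n), mact σ τ f = f) :
    QPOrbitRestorable (k + 7) n f := by
  let Supp : ℕ → Set (MvPolynomial (Fin n × Fin n) ℂ) := fun m =>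
    {v | v ∈ derivChain f m ∧ ∃ Y : Finset (Fin n), Y.card ≤ k ∧
      ∀ ρ : Perm (Fin n), (∀ i ∈ Y, ρ i = i) → Perm.sign ρ = 1 → ren ρ v = v}
  have hspan : ∀ m, derivChain f m ≤ Submodule.span ℂ (Supp m) := fun m =>
    hKey _ (finrank_derivChain_le w a hf m).1 (finrank_derivChain_le w a hf m).2
      (fun σ τ v hv => mact_mem_derivChain hsym σ τ m hv)
  have hfin : ∀ m, ∃ T : Finset (MvPolynomial (Fin n × Fin n) ℂ), (↑T : Set _) ⊆ Supp m ∧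
      derivChain f m ≤ Submodule.span ℂ (T : Set _) := by
    intro m
    haveI := (finrank_derivChain_le w a hf m).1
    obtain ⟨S₀, hS₀⟩ := (Submodule.fg_iff_finiteDimensional _).2 (finrank_derivChain_le w a hf m).1
    have hch : ∀ s ∈ S₀, ∃ F : Finset (MvPolynomial (Fin n × Fin n) ℂ), (↑F : Set _) ⊆ Supp m ∧
        s ∈ Submodule.span ℂ (F : Set _) := by
      intro s hs
      have hs' : s ∈ derivChain f m := by rw [← hS₀]; exact Submodule.subset_span hs
      exact Submodule.mem_span_finite_of_mem_span (hspan m hs')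
    choose F hF using hch
    refine ⟨S₀.attach.biUnion fun s => F s.1 s.2, ?_, ?_⟩
    · intro v hv
      simp only [Finset.coe_biUnion, Finset.coe_attach, Set.mem_univ, Set.iUnion_true, Set.mem_iUnion] at hv
      obtain ⟨s, hv⟩ := hv
      exact (hF s.1 s.2).1 hv
    · rw [← hS₀, Submodule.span_le]
      intro s hs
      have h := (hF s hs).2
      refine Submodule.span_mono ?_ h
      intro v hv
      simp only [Finset.coe_biUnion, Finset.coe_attach, Set.mem_univ, Set.iUnion_true, Set.mem_iUnion]
      exact ⟨⟨s, hs⟩, hv⟩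
  choose T hT using hfin
  let T' : ℕ → Finset (MvPolynomial (Fin n × Fin n) ℂ) := fun m => if m = 0 then insert f (T 0) else T m
  have hT'sub : ∀ m, ∀ t ∈ T' m, t ∈ derivChain f m ∧ ∃ Y : Finset (Fin n), Y.card ≤ k ∧
      ∀ ρ : Perm (Fin n), (∀ i ∈ Y, ρ i = i) → Perm.sign ρ = 1 → ren ρ t = t := by
    intro m t ht
    by_cases hm : m = 0
    · subst hm
      simp only [T', if_true, Finset.mem_insert] at ht
      rcases ht with rfl | ht
      · refine ⟨mem_derivChain_zero _, ∅, by simp, fun ρ _ _ => ?_⟩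
        rw [ren_eq_mact]; exact hsym ρ ρ
      · exact (hT 0).1 ht
    · simp only [T', if_neg hm] at ht
      exact (hT m).1 ht
  have hT'span : ∀ m, derivChain f m ≤ Submodule.span ℂ (T' m : Set _) := by
    intro m
    refine (hT m).2.trans (Submodule.span_mono ?_)
    by_cases hm : m = 0
    · subst hm; simp only [T', if_true, Finset.coe_insert]; exact Set.subset_insert _ _
    · simp only [T', if_neg hm]; exact le_rfl
  refine DerivativeTowerAlt.qpOrbitRestorable_of_altTower (d := d) T'
    (fun m t ht => isHomogeneous_of_mem_derivChain w a hf (hT'sub m t ht).1)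
    (fun m t ht => (hT'sub m t ht).2)
    (fun m _ t ht x => hT'span (m + 1) (pderiv_mem_derivChain (hT'sub m t ht).1 x))
    (by simp [T']) fun σ => ?_
  rw [ren_eq_mact]; exact hsym σ σ

/-- **THE ΣΛΣ SUB-RUNG OF A_∞ MODULO THE ALT-SPANNING PROPERTY (family form).**  If at every level `n` the
small-modules alt-spanning property holds for dimension `≤ r_n` with one `k`, then every matrix-symmetric
family `f` with `f n = Σ_{i<r_n} a_i ℓ_{w_i}^{d_n}` (unbounded top fan-in, arbitrary forms and coefficients)
is quasi-polynomially orbit-restorable. [folklore] -/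
theorem sigmaLambdaSigma_restoration_of_smallModulesAltSupported {k : ℕ}
    (f : (n : ℕ) → MvPolynomial (Fin n × Fin n) ℂ) (hsym : IsMatrixSymmetric f) (r d : ℕ → ℕ)
    (hKey : ∀ n : ℕ, ∀ W : Submodule ℂ (MvPolynomial (Fin n × Fin n) ℂ), FiniteDimensional ℂ W →
      Module.finrank ℂ W ≤ r n → (∀ σ τ : Perm (Fin n), ∀ w ∈ W, mact σ τ w ∈ W) →
        W ≤ Submodule.span ℂ {v | v ∈ W ∧ ∃ Y : Finset (Fin n), Y.card ≤ k ∧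
          ∀ ρ : Perm (Fin n), (∀ i ∈ Y, ρ i = i) → Perm.sign ρ = 1 → ren ρ v = v})
    (h : ∀ n : ℕ, ∃ (w : Fin (r n) → (Fin n × Fin n) → ℂ) (a : Fin (r n) → ℂ),
      f n = ∑ i, C (a i) * lin (w i) ^ (d n)) :
    ∃ c : ℕ, ∀ n : ℕ, QPOrbitRestorable c n (f n) := by
  refine ⟨k + 7, fun n => ?_⟩
  obtain ⟨w, a, hf⟩ := h n
  refine sigmaLambdaSigma_restorable_of_smallModulesAltSupported (hKey n) w a hf fun σ τ => ?_
  rw [mact_apply]; exact hsym n σ τ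

end DerivativeTower

end Summit.ValiantsHypothesis.ValiantsHypothesis.Theorems

end
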